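/-
Copyright (c) 2026 the pub-hodgecm-mathlib formalisation cell (harness21).  Prover seat hodgecm-mathlib-F0P3a-p08 (g18): «S3-ram» seeding wave (LEAD F0P3a-plan (g12)
T11-41; owner p06 (g15); RANK-CM tame-ramified twin, holder A-p19 (g26)), organ (r1) — the unipotent classes of `U(3)` at a TAMELY RAMIFIED place; 2026-09-01.
-/
import Literature.NumberTheory.Automorphic.UnitaryThreeUnipotentClassesUnramified   -- ★ p846484 (this seat): entry formula `conj_cornerUnipotent_sub_one_apply`, `inv_apply_eq_of_mem_unitaryGroupOfForm`, `isIntMatrix_inv_of_mem_unitaryGroupOfForm`, levels of `n(t)`; brings ★ `IntMatrixLevelConjugation` (FILE 0), ★ `UnitaryThreeSingularUnipotentClasses` (`exists_conj_eq_iff_exists_norm_mul`), ★ `UnitaryThreeUnipotentConjugacy` (`exists_conj_coe_eq_cornerUnipotent_of_sq_eq_zero`)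
import HarnessLib

/-!
# The unipotent classes of `U(3)` over a TAMELY RAMIFIED quadratic extension of a local field: fixed elements have even valuation, the `σ`-fixed ∕ `σ`-skew
# dichotomies modulo norms, and the two transvection classes `[n(ϖ)]`, `[n(ηϖ)]` (Rogawski 1990 §3.9; Serre, *Local Fields*, Ch. V §3)

Topic `NumberTheory/Automorphic`; namespace `Literature.NumberTheory.Automorphic.UnitaryGroup`.  THEOREMS ONLY (no definition, no instance, no notation, no named fact,
no `sorry`); kernel lane `--supports stmt-HodgeConjecture-24833`.  Cell `pub/hodgecm-mathlib` (D-0151), crux H413; «S3-ram» seeding wave (LEAD T11-41, owner p06 (g15),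
table `S3RAM-ORGANS.md` row «RANK-CM ram twin», holder A-p19 (g26)); this file is organ **(r1)**, the ramified twin of ★ `UnitaryThreeUnipotentClassesUnramified` (p846484)
§3–§4, in the SAME currency: a valued field `K` (`Valued K ℤᵐ⁰`), an isometric involution `σ`, the split form `J₀ = antidiag(1,1,1)`, `n(t) = 1 + t·E₀₂`.

THE MATHEMATICS.  At a tamely ramified place the datum is: a uniformiser `ϖ` with `σϖ = −ϖ` (★ p846371 `ramifiedBlock_adicCompletion` (R1)), RESIDUAL TRIVIALITY
`|σx − x| < 1` on `𝒪` (R2), `|2| = 1`, «every `σ`-fixed principal unit is a norm `z·σz`» (R4), and the INDEX-TWO structure of the `σ`-fixed units modulo norms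
(★ `RamifiedQuadraticNorm.exists_fixed_isUnit_not_exists_mul_map_eq` ∕ `exists_mul_map_eq_or_eq_mul`, Serre Ch. V §3 Cor. 2: `U_F ∕ N U_E ≅ k̄ˣ ∕ k̄ˣ²`): a `σ`-fixed
unit `η` which is NOT a norm, and every `σ`-fixed unit is `zσz` or `η·zσz`.  All five are HYPOTHESES here (discharged at CM places by the cited ★ files), so the file is
pure valued-field algebra.
(§1) A non-zero `σ`-FIXED element has EVEN valuation (an odd one would give a skew unit `u`, `|σu − u| = |2u| = 1`, contradicting (R2)).  (§2) Hence every non-zero SKEW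
`t` (`σt = −t`; `t∕ϖ` is fixed) is `N(z)·ϖ` or `N(z)·ηϖ`, and every non-zero FIXED `s` is `N(z)` or `η·N(z)` (`π = ϖσϖ` is a fixed NORM of valuation `exp(−2)` absorbing
the even valuation); and the non-norm unit in `|·|`-spelling: `|η − σz·z| = 1` for all integral `z`.  (§3) THE SINGULAR CLASSES:
a square-zero unipotent `g ∈ U(σ, J₀)` is `1`, or conjugate to `n₀ = n(ϖ)`, or to `n₁ = n(ηϖ)` (★ `exists_conj_coe_eq_cornerUnipotent_of_sq_eq_zero` ∘ §2 ∘ ★ criterion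
`exists_conj_eq_iff_exists_norm_mul`), and `n₀ ≁ n₁` (else `η` is a norm).  UNLIKE THE UNRAMIFIED CASE both representatives have `|t| = |ϖ|`: the level pieces
`K(1) ∖ K(2)`, `K ∖ K(1)` do NOT separate the two classes.  (§4 — MOVED) The separating residue-square-class PIECES `P(1), P(ε)` of level one (the cure of the obstruction «both classes have `|t| = |ϖ|`, so the
level pieces `K(1) ∖ K(2)`, `K ∖ K(1)` of ★ p846543 do not separate them») live in ★ `ResidueSquareClassLevelPiece` (A-p19 (g26), p846824); this file supplies its
`hε` token in `|·|`-spelling (`v_sub_norm_eq_one_of_not_norm`) and the class list the RANK-ram head indexes.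
HONEST LABEL: HC_CM is proved only modulo the 2 remaining named inputs (hLiu418 24832, h413 24833) until rung 0 closes; nothing printed is asserted here.

## References
* [Rogawski1990] J. D. Rogawski, *Automorphic Representations of Unitary Groups in Three Variables* (1990), §3.9 p. 32 (the singular classes `t mod N E^×`), §1.10 p. 9.
* [Serre1979] J.-P. Serre, *Local Fields*, GTM 67 (1979), Ch. V §3 Prop. 5, Cor. 2 p. 86 (`U_K ∕ N U_L` cyclic of order 2, totally ramified tame).
* [Flicker1998UnitaryFL] Y. Z. Flicker, *Elementary proof of the fundamental lemma for a unitary group*, Canad. J. Math. 50 (1998), Prop. 7 p. 84.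
-/

set_option autoImplicit false

open scoped Matrix MatrixGroups Valued WithZero
open Matrix

namespace Literature.NumberTheory.Automorphic.UnitaryGroup

open Literature.NumberTheory.Automorphic.HermitianLattice Literature.NumberTheory.Automorphic.UnitaryLatticeTree

variable {K : Type*} [Field K] [Valued K ℤᵐ⁰] (σ : K →+* K)

/-! ## §1 Fixed elements have even valuation at a tamely ramified place -/

section Fixed

/-- **A NON-ZERO `σ`-FIXED ELEMENT HAS EVEN VALUATION** (tamely ramified datum: `σϖ = −ϖ`, `|ϖ| = exp(−1)`, `|σx − x| < 1` on `𝒪`, `|2| = 1`, `σ` isometric): an odd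
valuation `n` odd would make the unit `u = x·ϖ^{n}` `σ`-SKEW, `|σu − u| = |2u| = 1`. [cite: Serre1979, Ch. V §3 p. 86] -/
theorem exists_v_eq_exp_two_mul_of_fixed {ϖ : K} (hvϖ : Valued.v ϖ = WithZero.exp (-1 : ℤ)) (hσϖ : σ ϖ = -ϖ)
    (hres : ∀ x : K, Valued.v x ≤ 1 → Valued.v (σ x - x) < 1) (h2 : Valued.v (2 : K) = 1) {x : K} (hσx : σ x = x) (hx : x ≠ 0) :
    ∃ m : ℤ, Valued.v x = WithZero.exp (2 * m) := by
  have hvx0 : Valued.v x ≠ 0 := (Valuation.ne_zero_iff _).2 hx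
  obtain ⟨n, hn⟩ : ∃ n : ℤ, Valued.v x = WithZero.exp n := ⟨WithZero.log (Valued.v x), (WithZero.exp_log hvx0).symm⟩
  rcases Int.even_or_odd n with ⟨a, ha⟩ | hodd
  · exact ⟨a, by rw [hn, ha, two_mul]⟩
  · exfalso
    have hϖ0 : ϖ ≠ 0 := fun h => by rw [h, map_zero] at hvϖ; exact WithZero.exp_ne_zero hvϖ.symm
    -- the `σ`-skew unit `u = x·ϖ^{-n}` (written `x·ϖ^n` with `|x| = exp n`, `|ϖ| = exp(−1)`)
    set u : K := x * ϖ ^ n with hu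
    have hvu : Valued.v u = 1 := by
      rw [hu, map_mul, map_zpow₀, hn, hvϖ, ← WithZero.exp_zsmul, smul_eq_mul, ← WithZero.exp_add, ← WithZero.exp_zero]
      congr 1; ring
    have hσu : σ u = -u := by
      rw [hu, map_mul, map_zpow₀, hσx, hσϖ, hodd.neg_zpow, mul_neg]
    have hlt := hres u hvu.le
    rw [hσu, show -u - u = -(2 * u) by ring, Valuation.map_neg, map_mul, h2, hvu, one_mul] at hlt
    exact lt_irrefl _ hlt

end Fixed

/-! ## §2 Skew elements modulo norms: `N(z)·ϖ` or `N(z)·ηϖ` -/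

section Skew

/-- **EVERY NON-ZERO SKEW `t` IS `N(z)·ϖ` OR `N(z)·ηϖ`** (`σt = −t`; `t∕ϖ` is fixed of even valuation `2m` (§1), `(t∕ϖ)·(ϖσϖ)^m` is a fixed unit, hence `zσz` or `η·zσz`).
[cite: Rogawski1990, §3.9 p. 32] [cite: Serre1979, Ch. V §3 Cor. 2 p. 86] -/
theorem exists_norm_mul_eq_of_skew (hσ : ∀ z : K, σ (σ z) = z) (hvσ : ∀ a, Valued.v (σ a) = Valued.v a) {ϖ : K} (hvϖ : Valued.v ϖ = WithZero.exp (-1 : ℤ))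
    (hσϖ : σ ϖ = -ϖ) (hres : ∀ x : K, Valued.v x ≤ 1 → Valued.v (σ x - x) < 1) (h2 : Valued.v (2 : K) = 1) {η : K}
    (hU : ∀ u : K, σ u = u → Valued.v u = 1 → ∃ z : K, z * σ z = u ∨ η * (z * σ z) = u)
    {t : K} (hσt : σ t = -t) (ht : t ≠ 0) :
    ∃ z : K, z ≠ 0 ∧ (t = z * σ z * ϖ ∨ t = z * σ z * (η * ϖ)) := by
  have hϖ0 : ϖ ≠ 0 := fun h => by rw [h, map_zero] at hvϖ; exact WithZero.exp_ne_zero hvϖ.symm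
  -- `c = t ∕ ϖ` is fixed, of even valuation `2m`
  set c : K := t / ϖ with hc
  have hσc : σ c = c := by rw [hc, map_div₀, hσt, hσϖ, neg_div_neg_eq]
  have hc0 : c ≠ 0 := div_ne_zero ht hϖ0
  obtain ⟨m, hm⟩ := exists_v_eq_exp_two_mul_of_fixed σ hvϖ hσϖ hres h2 hσc hc0
  -- `π = ϖ·σϖ` is a fixed norm of valuation `exp(−2)`; `u = c·π^m` is a fixed unit
  set π : K := ϖ * σ ϖ with hπ
  have hσπ : σ π = π := by rw [hπ, map_mul, hσ, mul_comm]
  have hvπ : Valued.v π = WithZero.exp (-2 : ℤ) := by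
    rw [hπ, map_mul, hvσ, hvϖ, ← WithZero.exp_add]; norm_num
  have hπ0 : π ≠ 0 := fun h => by rw [h, map_zero] at hvπ; exact WithZero.exp_ne_zero hvπ.symm
  set u : K := c * π ^ m with hu
  have hσu : σ u = u := by rw [hu, map_mul, map_zpow₀, hσc, hσπ]
  have hvu : Valued.v u = 1 := by
    rw [hu, map_mul, map_zpow₀, hm, hvπ, ← WithZero.exp_zsmul, smul_eq_mul, ← WithZero.exp_add, ← WithZero.exp_zero]
    congr 1; ring
  have hu0 : u ≠ 0 := fun h => by rw [h, map_zero] at hvu; exact zero_ne_one hvu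
  obtain ⟨z, hz⟩ := hU u hσu hvu
  have hz0 : z ≠ 0 := by
    rintro rfl
    rw [zero_mul, mul_zero] at hz
    rcases hz with h | h <;> exact hu0 h.symm
  -- unwind: `t = c·ϖ`, `c = u·π^{−m}`, `π^{−m} = ϖ^{−m}·σ(ϖ^{−m})`
  have htc : t = c * ϖ := by rw [hc, div_mul_cancel₀ _ hϖ0]
  have hcu : c = u * π ^ (-m) := by rw [hu, _root_.zpow_neg, mul_inv_cancel_right₀ (zpow_ne_zero m hπ0)]
  have hπm : π ^ (-m) = ϖ ^ (-m) * σ (ϖ ^ (-m)) := by rw [map_zpow₀, ← mul_zpow]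
  refine ⟨z * ϖ ^ (-m), mul_ne_zero hz0 (zpow_ne_zero _ hϖ0), ?_⟩
  rcases hz with h | h
  · left
    rw [htc, hcu, ← h, hπm, map_mul]; ring
  · right
    rw [htc, hcu, ← h, hπm, map_mul]; ring

/-- **EVERY NON-ZERO FIXED `s` IS `N(z)` OR `η·N(z)`** (`σs = s`; even valuation `2m` by §1, `s·(ϖσϖ)^m` is a fixed unit, hence `zσz` or `η·zσz`; `z ≠ 0`) — the `σ`-fixed
dichotomy `K_v^× = N(L_w^×) ⊔ η·N(L_w^×)` at a tamely ramified place. [cite: Serre1979, Ch. V §3 Cor. 2 p. 86] [cite: Rogawski1990, §3.9 p. 32] -/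
theorem exists_norm_mul_eq_of_fixed (hσ : ∀ z : K, σ (σ z) = z) (hvσ : ∀ a, Valued.v (σ a) = Valued.v a) {ϖ : K} (hvϖ : Valued.v ϖ = WithZero.exp (-1 : ℤ))
    (hσϖ : σ ϖ = -ϖ) (hres : ∀ x : K, Valued.v x ≤ 1 → Valued.v (σ x - x) < 1) (h2 : Valued.v (2 : K) = 1) {η : K}
    (hU : ∀ u : K, σ u = u → Valued.v u = 1 → ∃ z : K, z * σ z = u ∨ η * (z * σ z) = u)
    {s : K} (hσs : σ s = s) (hs : s ≠ 0) :
    ∃ z : K, z ≠ 0 ∧ (s = z * σ z ∨ s = η * (z * σ z)) := by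
  have hϖ0 : ϖ ≠ 0 := fun h => by rw [h, map_zero] at hvϖ; exact WithZero.exp_ne_zero hvϖ.symm
  obtain ⟨m, hm⟩ := exists_v_eq_exp_two_mul_of_fixed σ hvϖ hσϖ hres h2 hσs hs
  -- `π = ϖ·σϖ` is a fixed norm of valuation `exp(−2)`; `u = s·π^m` is a fixed unit
  set π : K := ϖ * σ ϖ with hπ
  have hσπ : σ π = π := by rw [hπ, map_mul, hσ, mul_comm]
  have hvπ : Valued.v π = WithZero.exp (-2 : ℤ) := by
    rw [hπ, map_mul, hvσ, hvϖ, ← WithZero.exp_add]; norm_num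
  have hπ0 : π ≠ 0 := fun h => by rw [h, map_zero] at hvπ; exact WithZero.exp_ne_zero hvπ.symm
  set u : K := s * π ^ m with hu
  have hσu : σ u = u := by rw [hu, map_mul, map_zpow₀, hσs, hσπ]
  have hvu : Valued.v u = 1 := by
    rw [hu, map_mul, map_zpow₀, hm, hvπ, ← WithZero.exp_zsmul, smul_eq_mul, ← WithZero.exp_add, ← WithZero.exp_zero]
    congr 1; ring
  have hu0 : u ≠ 0 := fun h => by rw [h, map_zero] at hvu; exact zero_ne_one hvu
  obtain ⟨z, hz⟩ := hU u hσu hvu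
  have hz0 : z ≠ 0 := by
    rintro rfl
    rw [zero_mul, mul_zero] at hz
    rcases hz with h | h <;> exact hu0 h.symm
  have hsu : s = u * π ^ (-m) := by rw [hu, _root_.zpow_neg, mul_inv_cancel_right₀ (zpow_ne_zero m hπ0)]
  have hπm : π ^ (-m) = ϖ ^ (-m) * σ (ϖ ^ (-m)) := by rw [map_zpow₀, ← mul_zpow]
  refine ⟨z * ϖ ^ (-m), mul_ne_zero hz0 (zpow_ne_zero _ hϖ0), ?_⟩
  rcases hz with h | h
  · left
    rw [hsu, ← h, hπm, map_mul]; ring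
  · right
    rw [hsu, ← h, hπm, map_mul]; ring

/-- **THE NON-NORM UNIT IN `|·|`-SPELLING**: if the fixed unit `η` is not a norm and every fixed principal unit is a norm, then `|η − σz·z| = 1` for every integral `z`
(for `|z| < 1` trivially; for `|z| = 1`, `|η − N(z)| < 1` would make `η∕N(z)` a fixed principal unit, hence `η = N(s)·N(z) = N(sz)`).  This is the `hε` token of
★ `ResidueSquareClassLevelPiece` (A-p19 (g26), p846824). [cite: Serre1979, Ch. V §3 Cor. 2 p. 86] -/
theorem v_sub_norm_eq_one_of_not_norm (hσ : ∀ z : K, σ (σ z) = z) (hvσ : ∀ a, Valued.v (σ a) = Valued.v a)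
    (hnorm1 : ∀ u : K, σ u = u → Valued.v (u - 1) < 1 → ∃ z : K, z * σ z = u)
    {η : K} (hση : σ η = η) (hvη : Valued.v η = 1) (hη : ¬ ∃ z : K, z * σ z = η) (z : K) (hz : Valued.v z ≤ 1) :
    Valued.v (η - σ z * z) = 1 := by
  rcases hz.lt_or_eq with hlt | heq
  · -- `|N(z)| < 1 = |η|`
    rw [Valuation.map_sub_eq_of_lt_left _ (by rw [map_mul, hvσ, hvη]; exact mul_lt_one_of_lt_of_le hlt hlt.le), hvη]
  · -- `|z| = 1`: `|η − N(z)| < 1` is impossible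
    have hN1 : Valued.v (σ z * z) = 1 := by rw [map_mul, hvσ, heq, mul_one]
    have hN0 : σ z * z ≠ 0 := (Valuation.ne_zero_iff _).1 (by rw [hN1]; exact one_ne_zero)
    have hle : Valued.v (η - σ z * z) ≤ 1 := by
      have h' := Valued.v.map_sub_le hvη.le hN1.le
      exact h'
    refine hle.lt_or_eq.resolve_left fun hlt => hη ?_
    -- `w = η ∕ N(z)` is a fixed principal unit
    set w : K := η / (σ z * z) with hw
    have hσw : σ w = w := by rw [hw, map_div₀, map_mul, hση, hσ, mul_comm z]
    have hw1 : Valued.v (w - 1) < 1 := by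
      rw [hw, div_sub_one hN0, map_div₀, hN1, div_one]
      exact hlt
    obtain ⟨s, hs⟩ := hnorm1 w hσw hw1
    refine ⟨s * z, ?_⟩
    rw [map_mul, show s * z * (σ s * σ z) = (s * σ s) * (σ z * z) by ring, hs, hw, div_mul_cancel₀ _ hN0]

end Skew

/-! ## §3 The singular unipotent classes `1`, `[n(ϖ)]`, `[n(ηϖ)]` -/

section Classes

/-- **THE SINGULAR UNIPOTENT CLASSES AT A TAMELY RAMIFIED PLACE ARE `{1}`, `[n(ϖ)]`, `[n(ηϖ)]`**: a square-zero unipotent `g ∈ U(σ, J₀)` is `1` or conjugate to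
`n₀ = n(ϖ)` or to `n₁ = n(ηϖ)` (★ `exists_conj_coe_eq_cornerUnipotent_of_sq_eq_zero` gives `n(t)`, `σt = −t`; §2 and ★ `exists_conj_eq_iff_exists_norm_mul`).
[cite: Rogawski1990, §3.9 p. 32, Prop. 3.9.1] [cite: Serre1979, Ch. V §3 Cor. 2 p. 86] -/
theorem sq_zero_unipotent_cases_ramified (hσ : ∀ z : K, σ (σ z) = z) (hvσ : ∀ a, Valued.v (σ a) = Valued.v a) {ϖ : K}
    (hvϖ : Valued.v ϖ = WithZero.exp (-1 : ℤ)) (hσϖ : σ ϖ = -ϖ) (hres : ∀ x : K, Valued.v x ≤ 1 → Valued.v (σ x - x) < 1) (h2 : Valued.v (2 : K) = 1)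
    {η : K} (hU : ∀ u : K, σ u = u → Valued.v u = 1 → ∃ z : K, z * σ z = u ∨ η * (z * σ z) = u)
    {n₀ n₁ : GL (Fin 3) K} (hn₀ : (n₀ : Matrix (Fin 3) (Fin 3) K) = !![1, 0, ϖ; 0, 1, 0; 0, 0, 1])
    (hn₁ : (n₁ : Matrix (Fin 3) (Fin 3) K) = !![1, 0, η * ϖ; 0, 1, 0; 0, 0, 1])
    {g : GL (Fin 3) K} (hg : g ∈ unitaryGroupOfForm σ ((StdForm.antidiagonal 3).over K))
    (hsq : ((g : Matrix (Fin 3) (Fin 3) K) - 1) * ((g : Matrix (Fin 3) (Fin 3) K) - 1) = 0) :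
    g = 1 ∨ (∃ k : GL (Fin 3) K, k ∈ unitaryGroupOfForm σ ((StdForm.antidiagonal 3).over K) ∧ k * g * k⁻¹ = n₀) ∨
      (∃ k : GL (Fin 3) K, k ∈ unitaryGroupOfForm σ ((StdForm.antidiagonal 3).over K) ∧ k * g * k⁻¹ = n₁) := by
  have hϖ0 : ϖ ≠ 0 := fun h => by rw [h, map_zero] at hvϖ; exact WithZero.exp_ne_zero hvϖ.symm
  obtain ⟨k, hk, t, hσt, hshape⟩ := exists_conj_coe_eq_cornerUnipotent_of_sq_eq_zero σ hσ hg hsq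
  by_cases ht : t = 0
  · left
    have h1 : k * g * k⁻¹ = 1 := Units.ext (by rw [hshape, ht, Units.val_one]; ext i j; fin_cases i <;> fin_cases j <;> rfl)
    calc g = k⁻¹ * (k * g * k⁻¹) * k := by group
      _ = 1 := by rw [h1, mul_one, inv_mul_cancel]
  · right
    have hσt' : σ t = -t := eq_neg_of_add_eq_zero_left hσt
    obtain ⟨z, hz0, hz⟩ := exists_norm_mul_eq_of_skew σ hσ hvσ hvϖ hσϖ hres h2 hU hσt' ht
    rcases hz with h | h
    · -- `t = N(z)·ϖ`: `n(t) ∼ n(ϖ)`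
      left
      obtain ⟨k', hk', hconj⟩ := (exists_conj_eq_iff_exists_norm_mul σ hσ hϖ0 hn₀ hshape).2 ⟨z, hz0, h⟩
      exact ⟨k'⁻¹ * k, mul_mem (inv_mem hk') hk, by rw [show k'⁻¹ * k * g * (k'⁻¹ * k)⁻¹ = k'⁻¹ * (k * g * k⁻¹) * k' by group, ← hconj]; group⟩
    · -- `t = N(z)·ηϖ`: `n(t) ∼ n(ηϖ)`
      right
      have hη0 : η ≠ 0 := by
        rintro rfl
        rw [zero_mul, mul_zero] at h
        exact ht h
      obtain ⟨k', hk', hconj⟩ := (exists_conj_eq_iff_exists_norm_mul σ hσ (mul_ne_zero hη0 hϖ0) hn₁ hshape).2 ⟨z, hz0, h⟩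
      exact ⟨k'⁻¹ * k, mul_mem (inv_mem hk') hk, by rw [show k'⁻¹ * k * g * (k'⁻¹ * k)⁻¹ = k'⁻¹ * (k * g * k⁻¹) * k' by group, ← hconj]; group⟩

omit [Valued K ℤᵐ⁰] in
/-- **`n(ϖ) ≁ n(ηϖ)`** when `η` is not a norm (★ criterion: conjugacy would give `ηϖ = zσz·ϖ`). [cite: Rogawski1990, §3.9 p. 32] -/
theorem not_exists_conj_cornerUnipotent_of_not_norm (hσ : ∀ z : K, σ (σ z) = z) {ϖ : K} (hϖ : ϖ ≠ 0) {η : K} (hη : ¬ ∃ z : K, z * σ z = η)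
    {n₀ n₁ : GL (Fin 3) K} (hn₀ : (n₀ : Matrix (Fin 3) (Fin 3) K) = !![1, 0, ϖ; 0, 1, 0; 0, 0, 1])
    (hn₁ : (n₁ : Matrix (Fin 3) (Fin 3) K) = !![1, 0, η * ϖ; 0, 1, 0; 0, 0, 1]) :
    ¬ ∃ k : GL (Fin 3) K, k ∈ unitaryGroupOfForm σ ((StdForm.antidiagonal 3).over K) ∧ k * n₀ * k⁻¹ = n₁ := by
  intro h
  obtain ⟨z, -, hz⟩ := (exists_conj_eq_iff_exists_norm_mul σ hσ hϖ hn₀ hn₁).1 h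
  exact hη ⟨z, mul_right_cancel₀ hϖ hz.symm⟩

end Classes


end Literature.NumberTheory.Automorphic.UnitaryGroup
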